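/-
Origin: expansion seat `planner-pub-hodgecm-prl1-g4-0`, handover #7 2026-08-18T08:11:13Z (`HOME/pub-hodgecm-prl1-g4/lean/Prl1g4/AdelicTorusThetaData.lean`, md5 c86af22f, 517 lines);
landed by the gen-7 packager in gate run 26 as `HodgeCM/Automorphic/AdelicTorusThetaData.lean` (import ^import Prl1g4\.→import HodgeCM.Automorphic. ×1; import ^import Pv[0-9]+g[0-9]+\.→import HodgeCM.PerL34. ×1).
-/
/-
HodgeCM / automorphic layer — publication cell pub-hodgecm, EXPANSION PROVER a-1 (pub-hodgecm-prl1-g4, HANDOVER #7).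
Imports my HANDOVER #5b `Prl1g4.AdelicUnitaryModel` (↦ `HodgeCM.Automorphic.AdelicUnitaryModel`) and pv06-g3's
HANDOVER #11b `Pv06g3.TorusUnitaryEmbedding` (↦ `HodgeCM.PerL34.TorusUnitaryEmbedding`; byte mirror in this root),
which itself imports pv11-g5's `SeesawTorus` (↦ `HodgeCM.PerL34.SeesawTorus`) and pv06-g3's `DiagonalTorusGL`
(↦ `HodgeCM.PerL34.DiagonalTorusGL`).  Complete proofs, no new axioms, no new hypotheses.
-/
import Summits.HodgeConjecture.HodgeCM.Automorphic.AdelicUnitaryModel_2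
import Summits.HodgeConjecture.HodgeCM.PerL34.TorusUnitaryEmbedding
import Mathlib.Tactic.NoncommRing

/-!
# The torus junction in the END STATE: `T₁₂(𝔸), T₃₄(𝔸) ↪ U(W)(𝔸)` are PerL's, no longer data

PerL v5 (under adjudication, NOT cited as fact), §3.2 (tex ll. 305–320) and Prop. 3.6: for a context with
`SeesawDatum` `(a₀, a₁, a₂, a₃; W₁ ⊕ W₂ ≅ W₃ ⊕ W₄)` the two seesaw tori are
`T₁₂ = U(W₁) × U(W₂) ⊂ U(W)` (diagonal in the basis adapted to `W = W₁ ⊥ W₂ = diag(a₀, a₁)`) and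
`T₃₄ = U(W₃) × U(W₄) ⊂ U(W)` (diagonal in the basis adapted to `W₃ ⊥ W₄ = diag(a₂, a₃)`, transported to
`W` by the isometry `g` of `SeesawDatum.iso : gᴴ·diag(a₀,a₁)·g = diag(a₂,a₃)`).  As topological groups
both are `SeesawTorus L⁺ L = U(1)_{L/L⁺}(𝔸) × U(1)_{L/L⁺}(𝔸)` (pv11-g5).  Up to HANDOVER #5b the END
STATE carried, per context, the two tori as bare TYPES with ten instance slots, and inside pv15-g2's
`KernelTorusCarrier` their Haar measures `ν` and embeddings `jT : T →ₜ* U(W)(𝔸)` as DATA.  Here: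

* §8 (KERNEL, generic): **congruent hermitian matrices have conjugate unitary groups** — over ANY
  commutative ring `R` with an endomorphism `σ`, if `(g.map σ)ᵀ·H·g = H'` for `g ∈ GL_n(R)` then
  `x ↦ g x g⁻¹ : unitaryGroup σ H' ≃* unitaryGroup σ H` (`unitaryGroupCongr`); for `g ∈ GL_n(L)` and the
  ADELIC groups of HANDOVER #5a: `Adelic.congrEquiv L g H H' hg : adelicUnitaryGroup L H' ≃ₜ* adelicUnitaryGroup L H`,
  carrying rational points to rational points (`congrEquiv_mem_rat`);
* §9 PerL's **two torus embeddings** into `U(W)(𝔸_{L₀})`, `W = diag(a₀, a₁)`: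
  `SeesawDatum.jT₁₂ S := TorusEmbedding.jT L ![a₀, a₁]` (pv06-g3, used BY NAME) and
  `SeesawDatum.jT₃₄ S := congrEquiv g ∘ TorusEmbedding.jT L ![a₂, a₃]`, `g := S.iso.choose`; both continuous
  monoid homs with `SeesawTorus.rat ≤ comap (adelicUnitaryRat)`; and their lifts into the MODEL group
  `↥(regimeSubgroup …)` of HANDOVER #5b v2 (`Adelic.regimeLift`: through `regimeEquiv` in the regime, trivial
  outside it — uniform statement `le_comap_regimeLift`);
* §10 `Universe.AdelicTorusThetaData hP` = `AdelicModelThetaData hP` with `T12 = T34 := SeesawTorus L⁺ L`,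
  `ν := SeesawTorus.haar` (pv11-g5) and `jT := jT₁₂ / jT₃₄` NO LONGER DATA; `toAdelicModelThetaData`; END STATE
  `Assembly.realisationExists_ofAdelicTorusData`, `perL_ofAdelicTorusData`, `COR_CM_endState_ofAdelicTorusData`.

Remaining DATA after this file: `emb`, `cover`, the sign recipe, the Weil theta model `wm` of each context over
the adelic groups, per torus side the carrier data `X, allowed, Tι, torus, w, β, χv` (pv15-g2's analytic
carrier), the theta one-forms; hypotheses as before (`M`, `hP` [PRINT], `A12/A34`, the ten `Inputs`, `hHR`).
-/

set_option autoImplicit false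

noncomputable section

open NumberField IsDedekindDomain TopologicalSpace MeasureTheory
open scoped Topology Matrix CompactlySupported

namespace HodgeCM

/-! ## §8 Congruent hermitian matrices have conjugate unitary groups -/

namespace Adelic

open Literature.AlgebraicGeometry.ShimuraVarieties (unitaryGroup mem_unitaryGroup_iff conjRingHomK)

section Congr

variable {R : Type*} [CommRing R] (σ : R →+* R) {n : Type} [Fintype n] [DecidableEq n]

/-- If `(g.map σ)ᵀ·H·g = H'` then `((g⁻¹).map σ)ᵀ·H'·g⁻¹ = H`. -/
theorem congr_inv (g : GL n R) (H H' : Matrix n n R)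
    (hg : ((g : Matrix n n R).map σ)ᵀ * H * (g : Matrix n n R) = H') :
    (((g⁻¹ : GL n R) : Matrix n n R).map σ)ᵀ * H' * ((g⁻¹ : GL n R) : Matrix n n R) = H := by
  rw [← hg]
  have e : (((g⁻¹ : GL n R) : Matrix n n R).map σ)ᵀ * (((g : Matrix n n R).map σ)ᵀ * H * (g : Matrix n n R)) *
      ((g⁻¹ : GL n R) : Matrix n n R) =
      ((((g⁻¹ : GL n R) : Matrix n n R).map σ)ᵀ * ((g : Matrix n n R).map σ)ᵀ) * H *
        ((g : Matrix n n R) * ((g⁻¹ : GL n R) : Matrix n n R)) := by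
    noncomm_ring
  rw [e, ← Matrix.transpose_mul, ← Matrix.map_mul, Units.mul_inv, Matrix.map_one σ (map_zero σ) (map_one σ),
    Matrix.transpose_one, one_mul, mul_one]

/-- **Conjugation by a congruence preserves unitarity**: `(g.map σ)ᵀ·H·g = H'`, `x ∈ U_σ(H')` ⇒ `g x g⁻¹ ∈ U_σ(H)`. -/
theorem conj_mem_unitaryGroup_of_congr (g : GL n R) (H H' : Matrix n n R)
    (hg : ((g : Matrix n n R).map σ)ᵀ * H * (g : Matrix n n R) = H') {x : GL n R}
    (hx : x ∈ unitaryGroup σ H') : g * x * g⁻¹ ∈ unitaryGroup σ H := by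
  rw [mem_unitaryGroup_iff] at hx ⊢
  rw [Units.val_mul, Units.val_mul, Matrix.map_mul, Matrix.map_mul, Matrix.transpose_mul, Matrix.transpose_mul]
  have e : (((g⁻¹ : GL n R) : Matrix n n R).map σ)ᵀ * (((x : Matrix n n R).map σ)ᵀ * ((g : Matrix n n R).map σ)ᵀ) *
      H * ((g : Matrix n n R) * (x : Matrix n n R) * ((g⁻¹ : GL n R) : Matrix n n R)) =
      (((g⁻¹ : GL n R) : Matrix n n R).map σ)ᵀ *
        (((x : Matrix n n R).map σ)ᵀ * (((g : Matrix n n R).map σ)ᵀ * H * (g : Matrix n n R)) * (x : Matrix n n R)) *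
        ((g⁻¹ : GL n R) : Matrix n n R) := by
    noncomm_ring
  rw [e, hg, hx]
  exact congr_inv σ g H H' hg

/-- **Congruent matrices have conjugate unitary groups**: `x ↦ g x g⁻¹ : U_σ(H') ≃* U_σ(H)` for
`(g.map σ)ᵀ·H·g = H'`. -/
def unitaryGroupCongr (g : GL n R) (H H' : Matrix n n R)
    (hg : ((g : Matrix n n R).map σ)ᵀ * H * (g : Matrix n n R) = H') : unitaryGroup σ H' ≃* unitaryGroup σ H where
  toFun x := ⟨g * x * g⁻¹, conj_mem_unitaryGroup_of_congr σ g H H' hg x.2⟩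
  invFun y := ⟨g⁻¹ * y * g, by
    simpa only [inv_inv] using conj_mem_unitaryGroup_of_congr σ g⁻¹ H' H (congr_inv σ g H H' hg) y.2⟩
  left_inv x := Subtype.ext (by simp [mul_assoc])
  right_inv y := Subtype.ext (by simp [mul_assoc])
  map_mul' x y := Subtype.ext (by simp [mul_assoc])

/-- (Ported verbatim from the HodgeCMPerL package; no docstring in the source.) -/
@[simp] theorem coe_unitaryGroupCongr (g : GL n R) (H H' : Matrix n n R)
    (hg : ((g : Matrix n n R).map σ)ᵀ * H * (g : Matrix n n R) = H') (x : unitaryGroup σ H') :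
    ((unitaryGroupCongr σ g H H' hg x : unitaryGroup σ H) : GL n R) = g * x * g⁻¹ := rfl

/-- (Ported verbatim from the HodgeCMPerL package; no docstring in the source.) -/
theorem continuous_unitaryGroupCongr [TopologicalSpace R] [IsTopologicalRing R] (g : GL n R) (H H' : Matrix n n R)
    (hg : ((g : Matrix n n R).map σ)ᵀ * H * (g : Matrix n n R) = H') : Continuous (unitaryGroupCongr σ g H H' hg) :=
  ((continuous_const.mul continuous_subtype_val).mul continuous_const).subtype_mk _

end Congr

section AdelicCongr

variable (L : Type) [Field L] [NumberField L] [IsCMField L] {n : Type} [Fintype n] [DecidableEq n]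

/-- A congruence over `L` is a congruence over `𝔸_L` (for `c ⊗ id`). -/
theorem congr_toAdeleGL (g : GL n L) (H H' : Matrix n n L)
    (hg : ((g : Matrix n n L).map (conjRingHomK L))ᵀ * H * (g : Matrix n n L) = H') :
    (((toAdeleGL L g : GL n (AdeleRing (𝓞 L) L)) : Matrix n n (AdeleRing (𝓞 L) L)).map (adeleConj L))ᵀ *
        H.map (algebraMap L (AdeleRing (𝓞 L) L)) * (toAdeleGL L g : GL n (AdeleRing (𝓞 L) L)) =
      H'.map (algebraMap L (AdeleRing (𝓞 L) L)) := by
  rw [val_toAdeleGL]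
  have hmap : ((g : Matrix n n L).map (algebraMap L (AdeleRing (𝓞 L) L))).map (adeleConj L) =
      ((g : Matrix n n L).map (conjRingHomK L)).map (algebraMap L (AdeleRing (𝓞 L) L)) := by
    rw [Matrix.map_map, Matrix.map_map]
    exact congrArg _ (funext fun x => adeleConj_algebraMap L x)
  rw [hmap, ← Matrix.transpose_map, ← Matrix.map_mul, ← Matrix.map_mul, hg]

/-- **Congruent hermitian matrices over `L` have conjugate ADELIC unitary groups** (topological group
isomorphism `x ↦ g_𝔸 x g_𝔸⁻¹`). -/
def congrEquiv (g : GL n L) (H H' : Matrix n n L)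
    (hg : ((g : Matrix n n L).map (conjRingHomK L))ᵀ * H * (g : Matrix n n L) = H') :
    adelicUnitaryGroup L H' ≃ₜ* adelicUnitaryGroup L H where
  toMulEquiv := unitaryGroupCongr (adeleConj L) (toAdeleGL L g) _ _ (congr_toAdeleGL L g H H' hg)
  continuous_toFun := continuous_unitaryGroupCongr (adeleConj L) (toAdeleGL L g) _ _ (congr_toAdeleGL L g H H' hg)
  continuous_invFun :=
    ((continuous_const.mul continuous_subtype_val).mul continuous_const).subtype_mk _

/-- (Ported verbatim from the HodgeCMPerL package; no docstring in the source.) -/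
@[simp] theorem coe_congrEquiv (g : GL n L) (H H' : Matrix n n L)
    (hg : ((g : Matrix n n L).map (conjRingHomK L))ᵀ * H * (g : Matrix n n L) = H') (x : adelicUnitaryGroup L H') :
    ((congrEquiv L g H H' hg x : adelicUnitaryGroup L H) : GL n (AdeleRing (𝓞 L) L)) =
      toAdeleGL L g * x * (toAdeleGL L g)⁻¹ := rfl

/-- `congrEquiv` maps RATIONAL points to rational points: `g γ g⁻¹ ∈ U(H)(L⁺)` for `γ ∈ U(H')(L⁺)`. -/
theorem congrEquiv_mem_rat (g : GL n L) (H H' : Matrix n n L)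
    (hg : ((g : Matrix n n L).map (conjRingHomK L))ᵀ * H * (g : Matrix n n L) = H')
    {γ : adelicUnitaryGroup L H'} (hγ : γ ∈ adelicUnitaryRat L H') :
    congrEquiv L g H H' hg γ ∈ adelicUnitaryRat L H := by
  rw [mem_adelicUnitaryRat_iff] at hγ ⊢
  obtain ⟨x, hx, hxγ⟩ := hγ
  refine ⟨g * x * g⁻¹, conj_mem_unitaryGroup_of_congr (conjRingHomK L) g H H' hg hx, ?_⟩
  rw [map_mul, map_mul, map_inv, hxγ, coe_congrEquiv]

end AdelicCongr

/-! ### Lifting an embedding into `U(H)(𝔸)` to the regime model group -/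

section RegimeLift

variable (L : CMField) {n : Type} [Fintype n] [DecidableEq n] (H : Matrix n n L)
variable {T : Type} [Group T] [TopologicalSpace T]

/-- `regimeEquiv` as a continuous monoid hom. -/
def regimeEquivHom (h : IsAnisotropic L H) : adelicUnitaryGroup L H →ₜ* ↥(regimeSubgroup L H) where
  toMonoidHom := (regimeEquiv L H h).toMulEquiv.toMonoidHom
  continuous_toFun := (regimeEquiv L H h).continuous

/-- (Ported verbatim from the HodgeCMPerL package; no docstring in the source.) -/
@[simp] theorem coe_regimeEquivHom (h : IsAnisotropic L H) (g : adelicUnitaryGroup L H) :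
    ((regimeEquivHom L H h g : ↥(regimeSubgroup L H)) : adelicUnitaryGroup L H) = g := rfl

open Classical in
/-- **Lift of a continuous hom `φ : T → U(H)(𝔸)` into the regime model group**: `regimeEquiv ∘ φ` in the regime
(`H` anisotropic), the trivial hom outside it (where the model group is trivial and nothing is claimed). -/
def regimeLift (φ : T →ₜ* adelicUnitaryGroup L H) : T →ₜ* ↥(regimeSubgroup L H) :=
  if h : IsAnisotropic L H then (regimeEquivHom L H h).comp φ else 1

variable {L H}

/-- (Ported verbatim from the HodgeCMPerL package; no docstring in the source.) -/
theorem regimeLift_of_isAnisotropic (h : IsAnisotropic L H) (φ : T →ₜ* adelicUnitaryGroup L H) :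
    regimeLift L H φ = (regimeEquivHom L H h).comp φ := by
  classical
  exact dif_pos h

/-- In the regime the lift IS `φ` on underlying adelic matrices. -/
@[simp] theorem coe_regimeLift_apply (h : IsAnisotropic L H) (φ : T →ₜ* adelicUnitaryGroup L H) (t : T) :
    ((regimeLift L H φ t : ↥(regimeSubgroup L H)) : adelicUnitaryGroup L H) = φ t := by
  rw [regimeLift_of_isAnisotropic h]
  rfl

/-- (Ported verbatim from the HodgeCMPerL package; no docstring in the source.) -/
theorem regimeLift_of_not_isAnisotropic (h : ¬ IsAnisotropic L H) (φ : T →ₜ* adelicUnitaryGroup L H) :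
    regimeLift L H φ = 1 := by
  classical
  exact dif_neg h

/-- **Rational points to rational points, uniformly**: if `φ` maps `Λ ≤ T` into `U(H)(L⁺)` then its regime lift
maps `Λ` into the model lattice `regimeRat` (in the regime by `regimeEquiv`, outside it trivially). -/
theorem le_comap_regimeLift (φ : T →ₜ* adelicUnitaryGroup L H) (Λ : Subgroup T)
    (hΛ : Λ ≤ (adelicUnitaryRat L H).comap φ.toMonoidHom) :
    Λ ≤ (regimeRat L H).comap (regimeLift L H φ).toMonoidHom := by
  intro t ht
  rw [Subgroup.mem_comap]
  by_cases h : IsAnisotropic L H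
  · change regimeLift L H φ t ∈ regimeRat L H
    rw [mem_regimeRat_iff, coe_regimeLift_apply h]
    exact hΛ ht
  · change regimeLift L H φ t ∈ regimeRat L H
    rw [regimeLift_of_not_isAnisotropic h]
    exact (regimeRat L H).one_mem

/-- (Ported verbatim from the HodgeCMPerL package; no docstring in the source.) -/
theorem continuous_regimeLift (φ : T →ₜ* adelicUnitaryGroup L H) : Continuous (regimeLift L H φ) :=
  (regimeLift L H φ).continuous

end RegimeLift

end Adelic

/-! ## §9 PerL's two torus embeddings `T₁₂, T₃₄ ↪ U(W)(𝔸_{L₀})` -/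

namespace StubTree.SeesawDatum

open HodgeCM.Adelic HodgeCM.PerL34 HodgeCM.PerL34.TorusEmbedding
open Literature.AlgebraicGeometry.ShimuraVarieties (conjRingHomK)

variable {L : CMField} (S : StubTree.SeesawDatum L)

local notation3 "L⁺" => maximalRealSubfield (L : Type)

/-- The Gram matrix `diag(a₀, a₁)` of `W = W₁ ⊥ W₂`. -/
abbrev gramW : Matrix (Fin 2) (Fin 2) L := Matrix.diagonal ![S.a 0, S.a 1]

/-- The Gram matrix `diag(a₂, a₃)` of `W₃ ⊥ W₄`. -/
abbrev gramW' : Matrix (Fin 2) (Fin 2) L := Matrix.diagonal ![S.a 2, S.a 3]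

/-- THE isometry `g : W₃ ⊥ W₄ ⥲ W` of the datum (`SeesawDatum.iso`, chosen once). -/
def isoGL : GL (Fin 2) L := S.iso.choose

/-- (Ported verbatim from the HodgeCMPerL package; no docstring in the source.) -/
theorem isoGL_spec :
    ((S.isoGL : Matrix (Fin 2) (Fin 2) L).map (conjRingHomK L))ᵀ * S.gramW * (S.isoGL : Matrix (Fin 2) (Fin 2) L) =
      S.gramW' := by
  have h := S.iso.choose_spec
  rw [Matrix.transpose_map] at h
  exact h

/-- **`jT₁₂ : T₁₂(𝔸) = U(W₁)(𝔸) × U(W₂)(𝔸) ↪ U(W)(𝔸)`**, diagonal in the basis adapted to `W = W₁ ⊥ W₂`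
(PerL l. 305/315) — pv06-g3's `TorusEmbedding.jT`, as a continuous monoid hom. -/
def jT₁₂ : SeesawTorus L⁺ L →ₜ* adelicUnitaryGroup L S.gramW where
  toMonoidHom := TorusEmbedding.jT (L : Type) ![S.a 0, S.a 1]
  continuous_toFun := continuous_jT (L : Type) ![S.a 0, S.a 1]

/-- (Ported verbatim from the HodgeCMPerL package; no docstring in the source.) -/
@[simp] theorem jT₁₂_apply (t : SeesawTorus L⁺ L) : S.jT₁₂ t = TorusEmbedding.jT (L : Type) ![S.a 0, S.a 1] t := rfl

/-- (Ported verbatim from the HodgeCMPerL package; no docstring in the source.) -/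
theorem jT₁₂_injective : Function.Injective S.jT₁₂ := jT_injective (L : Type) _

/-- `T₁₂(L₀) ↦ U(W)(L₀)`. -/
theorem rat_le_comap_jT₁₂ : SeesawTorus.rat L⁺ L ≤ (adelicUnitaryRat L S.gramW).comap S.jT₁₂.toMonoidHom :=
  rat_le_comap_jT (L : Type) _

/-- **`jT₃₄ : T₃₄(𝔸) = U(W₃)(𝔸) × U(W₄)(𝔸) ↪ U(W)(𝔸)`**: diagonal in the basis adapted to `W₃ ⊥ W₄ = diag(a₂, a₃)`,
transported into `U(W) = U(diag(a₀, a₁))` by conjugation with the isometry `g` of `SeesawDatum.iso` (§8). -/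
def jT₃₄ : SeesawTorus L⁺ L →ₜ* adelicUnitaryGroup L S.gramW :=
  (ContinuousMonoidHom.toContinuousMonoidHom (congrEquiv (L : Type) S.isoGL S.gramW S.gramW' S.isoGL_spec)).comp
    { toMonoidHom := TorusEmbedding.jT (L : Type) ![S.a 2, S.a 3]
      continuous_toFun := continuous_jT (L : Type) ![S.a 2, S.a 3] }

/-- (Ported verbatim from the HodgeCMPerL package; no docstring in the source.) -/
theorem coe_jT₃₄_apply (t : SeesawTorus L⁺ L) :
    ((S.jT₃₄ t : adelicUnitaryGroup L S.gramW) : GL (Fin 2) (AdeleRing (𝓞 L) L)) =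
      toAdeleGL (L : Type) S.isoGL * TorusEmbedding.toGL (L : Type) t * (toAdeleGL (L : Type) S.isoGL)⁻¹ := rfl

/-- (Ported verbatim from the HodgeCMPerL package; no docstring in the source.) -/
theorem jT₃₄_injective : Function.Injective S.jT₃₄ :=
  (congrEquiv (L : Type) S.isoGL S.gramW S.gramW' S.isoGL_spec).injective.comp (jT_injective (L : Type) _)

/-- `T₃₄(L₀) ↦ U(W)(L₀)` (the isometry `g` is `L`-rational). -/
theorem rat_le_comap_jT₃₄ : SeesawTorus.rat L⁺ L ≤ (adelicUnitaryRat L S.gramW).comap S.jT₃₄.toMonoidHom :=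
  fun _ ht => congrEquiv_mem_rat (L : Type) S.isoGL S.gramW S.gramW' S.isoGL_spec (rat_le_comap_jT (L : Type) _ ht)

/-- The two embeddings into the MODEL group of the context (HANDOVER #5b v2: `↥(regimeSubgroup L diag(a₀,a₁))`). -/
def jT₁₂Model (hP : PrintFact_unitaryCompact) : SeesawTorus L⁺ L →ₜ* (S.latticeModelW hP).G :=
  regimeLift L S.gramW S.jT₁₂

/-- See `jT₁₂Model`. -/
def jT₃₄Model (hP : PrintFact_unitaryCompact) : SeesawTorus L⁺ L →ₜ* (S.latticeModelW hP).G :=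
  regimeLift L S.gramW S.jT₃₄

/-- (Ported verbatim from the HodgeCMPerL package; no docstring in the source.) -/
theorem rat_le_comap_jT₁₂Model (hP : PrintFact_unitaryCompact) :
    SeesawTorus.rat L⁺ L ≤ (S.latticeModelW hP).Γ.comap (S.jT₁₂Model hP).toMonoidHom :=
  le_comap_regimeLift S.jT₁₂ _ S.rat_le_comap_jT₁₂

/-- (Ported verbatim from the HodgeCMPerL package; no docstring in the source.) -/
theorem rat_le_comap_jT₃₄Model (hP : PrintFact_unitaryCompact) :
    SeesawTorus.rat L⁺ L ≤ (S.latticeModelW hP).Γ.comap (S.jT₃₄Model hP).toMonoidHom :=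
  le_comap_regimeLift S.jT₃₄ _ S.rat_le_comap_jT₃₄

/-- In the regime (`W` anisotropic) the model embeddings ARE `jT₁₂`, `jT₃₄` on adelic matrices. -/
theorem subtype_jT₁₂Model_apply (hP : PrintFact_unitaryCompact) (h : IsAnisotropic L S.gramW)
    (t : SeesawTorus L⁺ L) : (regimeSubgroup L S.gramW).subtype (S.jT₁₂Model hP t) = S.jT₁₂ t :=
  coe_regimeLift_apply h _ t

/-- (Ported verbatim from the HodgeCMPerL package; no docstring in the source.) -/
theorem subtype_jT₃₄Model_apply (hP : PrintFact_unitaryCompact) (h : IsAnisotropic L S.gramW)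
    (t : SeesawTorus L⁺ L) : (regimeSubgroup L S.gramW).subtype (S.jT₃₄Model hP t) = S.jT₃₄ t :=
  coe_regimeLift_apply h _ t

end StubTree.SeesawDatum

/-! ## §10 Theta data with PerL's tori; END STATE -/

open Literature.AlgebraicGeometry.ShimuraVarieties

namespace Universe

open HodgeCM.PerL34 HodgeCM.PerL34.Annihilation HodgeCM.Adelic
open HodgeCM.Prior.Perl34File HodgeCM.Prior.Perl34File.Perl34

/-- **The torus-side carrier data that remain DATA** once the torus `T`, its Haar measure `ν` and its embedding
`jT` are fixed: pv15-g2's `KernelTorusCarrier` minus the fields `ν`, `jT`. -/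
structure TorusCarrierRest {G : Type} [Group G] [TopologicalSpace G] {Γ : Subgroup G} [MeasurableSpace (G ⧸ Γ)]
    {μQ : Measure (G ⧸ Γ)} {XU : Type} [TopologicalSpace XU]
    {HG : Type} [NormedAddCommGroup HG] [InnerProductSpace ℂ HG] [CompleteSpace HG]
    {SK SigIdxG : Type} [TopologicalSpace SK]
    (K : KernelCoreCarrier G Γ μQ XU HG SK SigIdxG)
    (T : Type) [Group T] [TopologicalSpace T] [MeasurableSpace T] where
  /-- the characters `χ` of `[T]` with `χ_∞ = w` — bare index type -/
  X : Type
  /-- `χ` arises from an allowed pair -/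
  allowed : X → Prop
  /-- index type of the elements of the compact torus `T(L₀ ⊗ ℝ)` -/
  Tι : Type
  /-- the compact torus inside `U(W)(𝔸)` -/
  torus : Tι → G
  /-- the weight (character) `w` of `T(L₀ ⊗ ℝ)` -/
  w : Tι → ℂ
  /-- the `T(L₀)`-partition of unity -/
  β : C_c(T, ℝ)
  /-- the character `χ` indexed by `x : X`, as a continuous function on `T(𝔸)` -/
  χv : X → C(T, ℂ)

/-- Re-attach a Haar measure and an embedding (reducible, so that `(…).ν`, `(…).jT` compute by `rfl`). -/
@[reducible] def TorusCarrierRest.toKernelTorusCarrier {G : Type} [Group G] [TopologicalSpace G] {Γ : Subgroup G}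
    [MeasurableSpace (G ⧸ Γ)] {μQ : Measure (G ⧸ Γ)} {XU : Type} [TopologicalSpace XU]
    {HG : Type} [NormedAddCommGroup HG] [InnerProductSpace ℂ HG] [CompleteSpace HG]
    {SK SigIdxG : Type} [TopologicalSpace SK] {K : KernelCoreCarrier G Γ μQ XU HG SK SigIdxG}
    {T : Type} [Group T] [TopologicalSpace T] [MeasurableSpace T]
    (R : TorusCarrierRest K T) (ν : Measure T) (jT : T →ₜ* G) : KernelTorusCarrier K T where
  X := R.X
  allowed := R.allowed
  Tι := R.Tι
  torus := R.torus
  w := R.w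
  ν := ν
  jT := jT
  β := R.β
  χv := R.χv

variable (U : Universe)


-- port_pkg: scope closed for this part
end Universe
end HodgeCM
end
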